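import Literature.Computability.MetaComplexity.LanguageCompressionFinal
import Literature.Computability.MetaComplexity.DPReconstructionK
import Literature.Computability.MetaComplexity.AvgCaseDerandomizationBFP
import Literature.Computability.MetaComplexity.AvgCaseTallyNE
import Literature.Computability.Complexity.PRGDerandomizationPromise
import HarnessLib

/-!
# Complexity meta: Hirahara 2021, Theorem 4.2 relative to ONE leaf — a `2^{εn}`-hard language in `E` (items 1–3 of Lemma 3.4)

Topic `Literature/Computability/MetaComplexity`, continuation of `LanguageCompressionFinal.lean`
(the named fact `Hirahara2021_languageCompression`, S. Hirahara, ECCC TR21-058 / STOC 2021,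
Thm. 4.2, proved there relative to Lemma 3.4 in promise form and to the `K`-form of Thm. 3.12).
Both of those hypotheses are consequences of the pseudorandom generator of Lemma 3.4 (p. 20):

> "Lemma 3.4 is based on the following four results. 1. `coNP × {T} ⊆ Avg¹_{1-n^{-c}}P` implies
> `NE = E` [BCGL92]. 2. `coNP × {U} ⊆ Avg¹_{1-n^{-c}}P` implies `pr-MA = pr-NP` [KS04]. 3. If `NE = E`
> and `pr-MA = pr-NP`, then `E ⊄ i.o.SIZE(2^{εn})` for some constant `ε > 0` [BFP05]. 4. If
> `E ⊄ i.o.SIZE(2^{εn})` for some constant `ε > 0`, then there exists a polynomial-time-computable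
> pseudorandom generator secure against linear-sized circuits [IW97]."

Item 4 and everything downstream of it are theorems of the tree: Impagliazzo–Wigderson's hardness
amplification (`exists_avgHard_E_of_hard_E`, `AvgCaseDerandomizationBFP.lean`), the quick
Nisan–Wigderson generator (`Complexity.exists_isSizePseudorandom_of_avgHard_E`, `NWQuickPRG.lean`),
`pr-BPP = pr-P` from it (`Complexity.PromiseBPP'_subset_PromiseP_of_avgHard_E`,
`PRGDerandomizationPromise.lean`), and — landed the same day — **the `K`-form of Thm. 3.12 from such a
generator** (`DPK.Hirahara2021_dpReconstructionK`, `DPReconstructionK.lean`). Hence: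

* `Hirahara2021_dpReconstructionK_param` — the `K`-form of Thm. 3.12 for the deterministic tests with a
  unary parameter `w ↦ [(w, 1^m) ∈ D₀]` used in Claim 4.7 (the shape `h312K` of
  `Hirahara2021_languageCompression_of`), from `DPK.Hirahara2021_dpReconstructionK` (auxiliary input
  `a = ⟨1^m, ε⟩`, no coins, the test re-paired by an `FP` map);
* **`Hirahara2021_languageCompression_of_hardE`** — Thm. 4.2 from the single hypothesis
  *`coNP × {U, T} ⊆ Avg¹_{1-n^{-c}}P` (some `c`) implies `E ⊄ i.o.SIZE(2^{εn})` for some `ε > 0`*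
  (items 1–3: a language in `E` whose circuit complexity is `≥ 2^{εn}` at all large `n`);
* **`Hirahara2021_languageCompression_of_lemma37`** — since item 1 is also a theorem of the tree
  (`Hirahara2021_exists_NTIME_two_pow_subset_DTIME_of_Avg1P`, `AvgCaseTallyNE.lean`, the [IKW02] form
  `NTIME(2ⁿ) ⊆ DTIME(2^{en})` of `NE = E`) as is the almost-everywhere diagonal language
  (`Complexity.exists_ae_hard_mem_E`, `TimeHierarchyAE.lean`), Buhrman–Fortnow–Pavan's proof of item 3
  (Thm. 3.1 of [BFP05], p. 6, by contradiction through their Lemma 3.7) runs under Hirahara's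
  hypothesis verbatim (`Hirahara2021_hardE_of_lemma37`, the twin of
  `exists_hard_E_of_DistNP_subset_AvgP_of_lemma37`), leaving Thm. 4.2 relative to exactly the
  statement of **BFP05 Lemma 3.7 under Hirahara's hypothesis** — "if for all `ε > 0`, `E` infinitely
  often has circuits of size `2^{εn}`, then for all `A ∈ E` there is `B ∈ NTIME(2ⁿ)` with `Aₙ = Bₙ`
  for infinitely many `n`" (its printed proof: probabilistically checkable proofs for `E` turned into
  Merlin–Arthur protocols by the small circuits, derandomised by [KS04] from the average-case
  hypothesis — items 2–3, the one ingredient the tree lacks; it is also the open leaf of the named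
  fact `BuhrmanFortnowPavan2004_PromiseBPP'_subset_PromiseP`).

No new named facts (D-0026): the remaining leaf stays an explicit hypothesis.

## References

* S. Hirahara, ECCC TR21-058 (2021), Thm. 4.2, Lemma 3.4 (p. 20, proof sketch items 1–4), Thm. 3.12
  [Hirahara2021].
* H. Buhrman, L. Fortnow, A. Pavan, *Some results on derandomization*, Theory Comput. Syst. 38 (2005),
  Thm. 3.1 (proof), Lemma 3.7 [BuhrmanFortnowPavan2004].
* R. Impagliazzo, A. Wigderson, STOC 1997, Thm. 1 [ImpagliazzoWigderson1997].
-/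

noncomputable section

namespace Literature.Computability.MetaComplexity

open _root_.Computability Polynomial Complexity Complexity.Classes Complexity.Nondeterministic
  Complexity.Brick Filter

/-- **Thm. 3.12 (`K`-form) for deterministic tests with a unary parameter.** From a quick
pseudorandom generator with logarithmic seed fooling linear-size circuits at all large output lengths
(the conclusion of Lemma 3.4), for every `D₀ ∈ P` there is a polynomial `q` such that whenever the test
`w ↦ [(w, 1^m) ∈ D₀]` `1/e`-distinguishes `DP_k(x; ·)` from uniform,
`K^{q(|x|+k+e+m)}(x) ≤ k + ⌊log₂ q(|x|+k+e+m)⌋` — the instance `t := m`, `b := ε`, no coins, of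
`DPK.Hirahara2021_dpReconstructionK` for the re-paired test `⟨⟨1^m, b⟩, y⟩ ↦ [⟨y, 1^m⟩ ∈ D₀]`.
[cite: Hirahara2021, Thm. 3.12 (as used in the proof of Thm. 4.2, Claim 4.7, p. 29)] -/
theorem Hirahara2021_dpReconstructionK_param (U : UniversalMachine)
    (hPRG : ∃ (F : List Bool → List Bool) (c : ℕ), F ∈ FP ∧
      ∀ᶠ N in atTop, IsSizePseudorandom (seedGenerator F (c * Nat.log 2 N + c) N))
    {D₀ : Language Bool} (hD₀ : D₀ ∈ Classes.P) :
    ∃ q : Polynomial ℕ, ∀ (x : List Bool) (m k e : ℕ), 1 ≤ e →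
      1 / (e : ℝ) ≤ dpAdvantage k x (fun w => D₀.boolIndicator (paramEnc (w, m))) →
        U.ktAt (q.eval (x.length + k + e + m)) x ≤
          ((k + Nat.log 2 (q.eval (x.length + k + e + m)) : ℕ) : ℕ∞) := by
  -- the re-paired test `⟨⟨u, b⟩, y⟩ ↦ [⟨y, u⟩ ∈ D₀]`, as a language in `P`
  have hgFP : fanoutFn sndF (fstF ∘ fstF) ∈ FP :=
    fanoutFn_mem_FP sndF_mem_FP (comp_mem_FP fstF_mem_FP fstF_mem_FP)
  obtain ⟨D', hD', hmem⟩ : ∃ D' : Language Bool, D' ∈ Classes.P ∧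
      ∀ (m : ℕ) (y : List Bool), (boolPair (boolPair (unaryEncodeNat m) []) y ∈ D' ↔ paramEnc (y, m) ∈ D₀) := by
    refine ⟨fanoutFn sndF (fstF ∘ fstF) ⁻¹' D₀, preimage_mem_P hD₀ hgFP, fun m y => ?_⟩
    change fanoutFn sndF (fstF ∘ fstF) (boolPair (boolPair (unaryEncodeNat m) []) y) ∈ D₀ ↔ _
    rw [fanoutFn_apply, Function.comp_apply, sndF_boolPair, fstF_boolPair, fstF_boolPair]
    rfl
  obtain ⟨p, hp⟩ := DPK.Hirahara2021_dpReconstructionK U hPRG hD'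
  refine ⟨p, fun x m k e he hadv => ?_⟩
  have h1 : uniformProb (x.length * k + 0)
      {zr | boolPair (boolPair (unaryEncodeNat m) []) (dpGen k x (zr.take (x.length * k)) ++ zr.drop (x.length * k)) ∈ D'} =
      uniformProb (x.length * k) {z | D₀.boolIndicator (paramEnc (dpGen k x z, m)) = true} := by
    rw [Nat.add_zero]
    refine ParamUniform.uniformProb_congr' fun z hz => ?_
    simp only [Set.mem_setOf_eq]
    rw [List.take_of_length_le hz.le, List.drop_eq_nil_of_le hz.le, List.append_nil, hmem]
    exact Set.mem_iff_boolIndicator _ _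
  have h2 : uniformProb (x.length * k + k + 0)
      {y | boolPair (boolPair (unaryEncodeNat m) []) y ∈ D'} =
      uniformProb (x.length * k + k) {w | D₀.boolIndicator (paramEnc (w, m)) = true} := by
    rw [Nat.add_zero]
    refine ParamUniform.uniformProb_congr' fun w _ => ?_
    simp only [Set.mem_setOf_eq]
    rw [hmem]
    exact Set.mem_iff_boolIndicator _ _
  have h := hp m [] x k 0 e he (by rw [h1, h2]; exact hadv)
  simp only [List.length_nil, Nat.mul_zero, Nat.add_zero] at h
  have harg : m + x.length + k + e = x.length + k + e + m := by omega
  rw [harg] at h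
  exact h

/-- **Hirahara 2021, Thm. 4.2 relative to a `2^{εn}`-hard language in `E`** (items 1–3 of the proof
sketch of Lemma 3.4): if the hypothesis `coNP × {U, T} ⊆ Avg¹_{1-n^{-c}}P` yields a language in `E` of
circuit complexity `≥ 2^{εn}` at all large `n` for some `ε > 0`, then `Hirahara2021_languageCompression`
holds — item 4 (IW97 amplification + the quick NW generator) gives both `pr-BPP = pr-P` (Lemma 3.4 in
promise form) and the generator consumed by the `K`-form of Thm. 3.12, and
`Hirahara2021_languageCompression_of` does the rest. [cite: Hirahara2021, Thm. 4.2 with Lemma 3.4 (proof sketch, item 4) and Thm. 3.12] -/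
theorem Hirahara2021_languageCompression_of_hardE
    (hE : (∃ c : ℕ, distClass coNP {uniformEnsemble, tallyEnsemble} ⊆ Avg1DeltaP fun n => 1 - 1 / (n : ℝ) ^ c) →
      ∃ L ∈ E, ∃ ε : ℝ, 0 < ε ∧ ∀ᶠ n : ℕ in atTop, (2 : ℝ) ^ (ε * n) ≤ (L.circuitSize n : ℝ)) :
    Hirahara2021_languageCompression := by
  refine Hirahara2021_languageCompression_of (fun hyp => ?_) (fun U hyp D₀ hD₀ => ?_)
  · obtain ⟨L', hL', ε', hε', hhard⟩ := exists_avgHard_E_of_hard_E (hE hyp)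
    exact PromiseBPP'_subset_PromiseP_of_avgHard_E hL' hε' hhard
  · obtain ⟨L', hL', ε', hε', hhard⟩ := exists_avgHard_E_of_hard_E (hE hyp)
    exact Hirahara2021_dpReconstructionK_param U (exists_isSizePseudorandom_of_avgHard_E hL' hε' hhard) hD₀

/-- **Items 1 and 3 of the proof sketch of Lemma 3.4, as far as the tree goes**: under Hirahara's
hypothesis, Buhrman–Fortnow–Pavan's Lemma 3.7 (in the weakest form consumed, `B ∈ NTIME(2ⁿ)`) yields
a language in `E` of circuit complexity `≥ 2^{εn}` at all large `n`. BFP's argument (Thm. 3.1, proof,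
p. 6) verbatim: otherwise every `A ∈ E` has `2^{εn}`-size circuits infinitely often for every `ε > 0`;
`NE = E` in the [IKW02] form `NTIME(2ⁿ) ⊆ DTIME(2^{en})`
(`Hirahara2021_exists_NTIME_two_pow_subset_DTIME_of_Avg1P`, item 1 under the hypothesis) and the
language `A ∈ E` missed by every `DTIME(2^{en})` language at every large length
(`Complexity.exists_ae_hard_mem_E`) contradict the `B ∈ NTIME(2ⁿ)` agreeing with `A` infinitely often.
[cite: BuhrmanFortnowPavan2004, Thm. 3.1 (proof) and Lemma 3.7] [cite: Hirahara2021, Lemma 3.4 (proof sketch, items 1–3)] -/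
theorem Hirahara2021_hardE_of_lemma37
    (hyp : ∃ c : ℕ, distClass coNP {uniformEnsemble, tallyEnsemble} ⊆ Avg1DeltaP fun n => 1 - 1 / (n : ℝ) ^ c)
    (h37 : (∀ A ∈ E, ∀ ε : ℝ, 0 < ε → ∃ᶠ n : ℕ in atTop, (A.circuitSize n : ℝ) ≤ (2 : ℝ) ^ (ε * n)) →
      ∀ A ∈ E, ∃ B ∈ NTIME (fun n => 2 ^ n), ∃ᶠ n : ℕ in atTop,
        ∀ x : List Bool, x.length = n → (x ∈ A ↔ x ∈ B)) :
    ∃ L ∈ E, ∃ ε : ℝ, 0 < ε ∧ ∀ᶠ n : ℕ in atTop, (2 : ℝ) ^ (ε * n) ≤ (L.circuitSize n : ℝ) := by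
  by_contra hno
  -- every language in `E` has small circuits infinitely often
  have hio : ∀ A ∈ E, ∀ ε : ℝ, 0 < ε → ∃ᶠ n : ℕ in atTop, (A.circuitSize n : ℝ) ≤ (2 : ℝ) ^ (ε * n) := by
    intro A hA ε hε
    by_contra hfr
    refine hno ⟨A, hA, ε, hε, ?_⟩
    exact (Filter.not_frequently.1 hfr).mono fun n hn => (not_le.1 hn).le
  obtain ⟨e, he⟩ := Hirahara2021_exists_NTIME_two_pow_subset_DTIME_of_Avg1P hyp
  obtain ⟨A, hA, hhard⟩ := exists_ae_hard_mem_E e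
  obtain ⟨B, hB, hagree⟩ := h37 hio A hA
  obtain ⟨n₀, hn₀⟩ := hhard B (he hB)
  have hev : ∀ᶠ n : ℕ in atTop, ∃ x : List Bool, x.length = n ∧ (x ∈ B ↔ x ∉ A) :=
    Filter.eventually_atTop.2 ⟨n₀, hn₀⟩
  obtain ⟨n, hag, x, hx, hdis⟩ := (hagree.and_eventually hev).exists
  have h1 := hag x hx
  tauto

/-- **Hirahara 2021, Thm. 4.2 relative to BFP05 Lemma 3.7 under Hirahara's hypothesis** — the one
published ingredient of Lemma 3.4 that the tree lacks (probabilistically checkable proofs for `E` as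
Merlin–Arthur protocols, derandomised by Köbler–Schuler from the average-case hypothesis; items 2–3 of
the proof sketch). Everything else of Thm. 4.2 — Lemma 3.4's items 1 and 4, Thm. 3.12, Lemma 3.6,
Lemma 4.5/4.6, `L' ∈ NP`, Claim 4.7 and the assembly — is proved in the tree.
[cite: Hirahara2021, Thm. 4.2 and Lemma 3.4 (proof sketch)] [cite: BuhrmanFortnowPavan2004, Lemma 3.7] -/
theorem Hirahara2021_languageCompression_of_lemma37
    (h37 : (∃ c : ℕ, distClass coNP {uniformEnsemble, tallyEnsemble} ⊆ Avg1DeltaP fun n => 1 - 1 / (n : ℝ) ^ c) →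
      (∀ A ∈ E, ∀ ε : ℝ, 0 < ε → ∃ᶠ n : ℕ in atTop, (A.circuitSize n : ℝ) ≤ (2 : ℝ) ^ (ε * n)) →
      ∀ A ∈ E, ∃ B ∈ NTIME (fun n => 2 ^ n), ∃ᶠ n : ℕ in atTop,
        ∀ x : List Bool, x.length = n → (x ∈ A ↔ x ∈ B)) :
    Hirahara2021_languageCompression :=
  Hirahara2021_languageCompression_of_hardE fun hyp => Hirahara2021_hardE_of_lemma37 hyp (h37 hyp)

end Literature.Computability.MetaComplexity
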